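import Summits.AnomalousDissipation.AnomalousDissipation.Theorems.MomentParityDefs
import Summits.AnomalousDissipation.AnomalousDissipation.Theorems.MomentParityQuarticGateBasis
import Literature.Analysis.FluidPDE.CylindricalGenerator
import Literature.Analysis.FluidPDE.EnergySpaceTorusGalerkinProofs
import Literature.Analysis.FluidPDE.StokesTorusProofs

/-!
# Crux `EnsembleRealization` (stmt-AnomalousDissipation-0215) — line `augmented-lift`,
# (M1a) piece (L1) `stub_augCurrentLevelBasisTools`: the Galerkin basis and the rate bound

For every truncation order `N` we produce an `L²`-orthonormal basis `g₀, …, g_{D-1}` of the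
real solenoidal mean-zero trigonometric polynomials on `T³` with spectrum in `freqBall N`, made of
smooth solenoidal mean-zero band-limited fields, which is complete
(`Σⱼ (u, gⱼ) gⱼ = P_N u` pointwise, for `u ∈ H` and for smooth solenoidal mean-zero test fields),
satisfies Bessel's inequality, and obeys the modewise RATE bound of the Riesz representer
`r_u = Σⱼ ⟨F(u), gⱼ⟩ gⱼ` of the tested Navier–Stokes generator on the ball `‖u‖ ≤ R`:
`‖r̂_u(k)‖ ≤ pathLip ν ‖f‖₁ R k − 1`.

* The basis is the orthonormal band basis `MomentParityQuarticGate.exists_bandBasis` of the tree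
  (Gram–Schmidt of the Parseval frame of `P_N H`); completeness for every `u ∈ H` is obtained by
  applying its (band-limited) completeness clause to `P_N u ∈ galerkinSpace N ≤ H`
  (`Torus.toLp_fourierTruncate_mem_galerkinSpace`, `Torus.galerkinSpace_le_energySpace_holds`) and
  `(P_N u, gⱼ) = (u, gⱼ)` (`Torus.integral_inner_fourierTruncate_eq`); Bessel is Mathlib's
  `Orthonormal.sum_inner_products_le` for the `L²` classes.
* RATE (FMRT 2001, Ch. IV (1.7)–(1.9) bookkeeping). With `α = r̂_u(k)` test the generator against
  the single real mode `w = Re (e_k α)`: `w ∈ P_N H`, so by completeness and linearity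
  `⟨F(u), w⟩ = Σⱼ (w, gⱼ) ⟨F(u), gⱼ⟩ = (r_u, w) = Re ⟪r̂_u(k), α⟫ = ‖α‖²`, while
  `|⟨F(u), w⟩| ≤ ‖α‖ (‖f‖₁ + |ν| 4π²|k|² ‖u‖ + 2π|k| ‖u‖²)` (`abs_nsGeneratorPairing_singleton_le`:
  `‖w‖_∞ ≤ ‖α‖`, `Δw = -4π²|k|² w`, `‖Dw(x) h‖ ≤ 2π |k·h| ‖α‖`). Hence `‖α‖ ≤ pathLip − 1`.

No definitions; namespace of the crux line.
-/

noncomputable section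

set_option linter.dupNamespace false

open MeasureTheory Set Filter Topology Function Metric UnitAddTorus
open scoped BigOperators ENNReal InnerProductSpace RealInnerProductSpace

namespace Summit.AnomalousDissipation.AnomalousDissipation.Theorems.EnsembleRealization

open Literature.Analysis.FunctionSpaces Literature.Analysis.FunctionSpaces.Torus
open Literature.Analysis.FluidPDE Literature.Analysis.FluidPDE.Torus
open Summit.AnomalousDissipation.AnomalousDissipation.Theorems.MomentParity

/-! ### The tested generator against a single real Fourier mode -/

/-- **Directional derivatives of a single real mode**: for `w = Re (e_k ζ)`,
`Dw(x) h = Re (2πi (k·h) e_k(x) ζ)`, so `‖Dw(x) h‖ ≤ 2π |k| ‖ζ‖ ‖h‖` (sharp in the direction,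
no dimensional factor). [folklore] -/
theorem norm_fderiv_realTrigPoly_singleton_le (k : Fin 3 → ℤ) (ζ : EuclideanSpace ℂ (Fin 3))
    (x : UnitAddTorus (Fin 3)) (h : EuclideanSpace ℝ (Fin 3)) :
    ‖Torus.fderiv (realTrigPoly {k} fun _ => ζ) x h‖ ≤
      2 * Real.pi * Real.sqrt (freqNormSq k) * ‖ζ‖ * ‖h‖ := by
  have hsm : IsSmooth (realTrigPoly {k} fun _ : Fin 3 → ℤ => ζ) := isSmooth_realTrigPoly _ _
  -- the directional derivative is the single real mode of amplitude `(2πi (k·h)) • ζ`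
  have key : Torus.fderiv (realTrigPoly {k} fun _ => ζ) x h =
      realTrigPoly {k} (fun _ => ((2 * Real.pi * Complex.I *
        ((∑ i, h i * (k i : ℝ) : ℝ) : ℂ)) • ζ)) x := by
    rw [realTrigPoly_singleton_apply, fderiv_apply_eq_sum_partialDeriv (hsm.isContDiff (by simp)) x h]
    simp_rw [partialDeriv_realTrigPoly, realTrigPoly_singleton_apply, smul_realPart_mFourier_smul]
    rw [← map_sum, ← Finset.smul_sum]
    congr 2
    simp_rw [smul_smul]
    rw [← Finset.sum_smul]
    congr 1
    push_cast
    rw [Finset.mul_sum]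
    exact Finset.sum_congr rfl fun i _ => by ring
  rw [key]
  refine (norm_realTrigPoly_singleton_le k _ x).trans ?_
  have hs : |∑ i, h i * (k i : ℝ)| ≤ Real.sqrt (freqNormSq k) * ‖h‖ := by
    have h1 : ∑ i, h i * (k i : ℝ) = ⟪latticeVec k, h⟫_ℝ := by
      rw [← sum_intCast_mul_eq_inner_latticeVec]
      exact Finset.sum_congr rfl fun i _ => mul_comm _ _
    have h2 : ‖latticeVec k‖ = Real.sqrt (freqNormSq k) := by
      rw [← Real.sqrt_sq (norm_nonneg _), EuclideanSpace.real_norm_sq_eq]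
      simp [freqNormSq, latticeVec_apply]
    rw [h1, ← h2]
    exact abs_real_inner_le_norm _ _
  rw [show (2 * Real.pi * Complex.I * ((∑ i, h i * (k i : ℝ) : ℝ) : ℂ)) =
      ((2 * Real.pi * ∑ i, h i * (k i : ℝ) : ℝ) : ℂ) * Complex.I by push_cast; ring,
    norm_smul, norm_mul, Complex.norm_I, mul_one, Complex.norm_real, Real.norm_eq_abs, abs_mul,
    abs_of_pos Real.two_pi_pos]
  calc 2 * Real.pi * |∑ i, h i * (k i : ℝ)| * ‖ζ‖
      ≤ 2 * Real.pi * (Real.sqrt (freqNormSq k) * ‖h‖) * ‖ζ‖ := by gcongr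
    _ = 2 * Real.pi * Real.sqrt (freqNormSq k) * ‖ζ‖ * ‖h‖ := by ring

/-- **The tested generator against a single real mode** `w = Re (e_k ζ)` on `H`:
`|⟨F(u), w⟩| ≤ ‖ζ‖ (‖f‖₁ + |ν| 4π²|k|² ‖u‖ + 2π |k| ‖u‖²)` — the force term by `‖w‖_∞ ≤ ‖ζ‖`,
the Stokes term by `Δw = -4π²|k|² w` and Cauchy–Schwarz, the inertial term by
`‖Dw(x) h‖ ≤ 2π|k| ‖ζ‖ ‖h‖` (FMRT 2001, Ch. IV (1.7)–(1.9), with all derivatives on `w`).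
[folklore] -/
theorem abs_nsGeneratorPairing_singleton_le (ν : ℝ)
    {f : UnitAddTorus (Fin 3) → EuclideanSpace ℝ (Fin 3)} (hf : Integrable f volume)
    (u : Torus.energySpace (Fin 3)) (k : Fin 3 → ℤ) (ζ : EuclideanSpace ℂ (Fin 3)) :
    |nsGeneratorPairing ν f u (realTrigPoly {k} fun _ => ζ)| ≤
      ‖ζ‖ * ((∫ x, ‖f x‖) + |ν| * (4 * Real.pi ^ 2 * freqNormSq k) * ‖u‖ +
        2 * Real.pi * Real.sqrt (freqNormSq k) * ‖u‖ ^ 2) := by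
  set w : UnitAddTorus (Fin 3) → EuclideanSpace ℝ (Fin 3) := realTrigPoly {k} fun _ => ζ with hw
  have hwle : ∀ x, ‖w x‖ ≤ ‖ζ‖ := fun x => norm_realTrigPoly_singleton_le k _ x
  have hw2 : MemLp w 2 volume := memLp_realTrigPoly _ _ 2
  have hu2 : MemLp ((u : Lp (EuclideanSpace ℝ (Fin 3)) 2 (volume : Measure (UnitAddTorus (Fin 3)))) :
      UnitAddTorus (Fin 3) → EuclideanSpace ℝ (Fin 3)) 2 volume := Lp.memLp _
  have hnorm : ‖(u : Lp (EuclideanSpace ℝ (Fin 3)) 2 (volume : Measure (UnitAddTorus (Fin 3))))‖ = ‖u‖ :=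
    (Submodule.coe_norm _).symm
  -- the force term
  have h1 : |∫ x, ⟪f x, w x⟫_ℝ| ≤ ‖ζ‖ * ∫ x, ‖f x‖ := by
    rw [← Real.norm_eq_abs, mul_comm, ← integral_mul_const]
    refine norm_integral_le_of_norm_le (hf.norm.mul_const _) (ae_of_all _ fun x => ?_)
    rw [Real.norm_eq_abs]
    exact (abs_real_inner_le_norm _ _).trans (mul_le_mul_of_nonneg_left (hwle x) (norm_nonneg _))
  -- the Stokes term
  have hL2w : ‖hw2.toLp w‖ ≤ ‖ζ‖ := by
    have hsq : ‖hw2.toLp w‖ ^ 2 ≤ ‖ζ‖ ^ 2 := by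
      rw [← integral_norm_sq_coe_eq, integral_congr_ae (hw2.coeFn_toLp.mono fun x hx => by
        show ‖(hw2.toLp w : UnitAddTorus (Fin 3) → EuclideanSpace ℝ (Fin 3)) x‖ ^ 2 = ‖w x‖ ^ 2
        rw [hx])]
      exact integral_norm_sq_realTrigPoly_singleton_le k _
    exact (pow_le_pow_iff_left₀ (norm_nonneg _) (norm_nonneg _) two_ne_zero).1 hsq
  have h2 : |ν * ∫ x, ⟪((u : Lp (EuclideanSpace ℝ (Fin 3)) 2 (volume : Measure (UnitAddTorus (Fin 3)))) :
      UnitAddTorus (Fin 3) → EuclideanSpace ℝ (Fin 3)) x, laplacian w x⟫_ℝ| ≤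
      ‖ζ‖ * (|ν| * (4 * Real.pi ^ 2 * freqNormSq k) * ‖u‖) := by
    have hlap : ∀ x, laplacian w x = (-(4 * Real.pi ^ 2 * freqNormSq k)) • w x :=
      fun x => laplacian_realTrigPoly_singleton k _ x
    simp_rw [hlap, real_inner_smul_right]
    rw [integral_const_mul]
    have hp := abs_pairing_coe_le hw2 u
    rw [pairing] at hp
    have hc0 : (0 : ℝ) ≤ 4 * Real.pi ^ 2 * freqNormSq k := mul_nonneg (by positivity) (freqNormSq_nonneg k)
    rw [abs_mul, abs_mul, abs_neg, abs_of_nonneg hc0]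
    calc |ν| * (4 * Real.pi ^ 2 * freqNormSq k * |∫ x, ⟪((u : Lp (EuclideanSpace ℝ (Fin 3)) 2
          (volume : Measure (UnitAddTorus (Fin 3)))) : UnitAddTorus (Fin 3) → EuclideanSpace ℝ (Fin 3)) x, w x⟫_ℝ|)
        ≤ |ν| * (4 * Real.pi ^ 2 * freqNormSq k * (‖u‖ * ‖ζ‖)) := by
          gcongr
          exact hp.trans (mul_le_mul_of_nonneg_left hL2w (norm_nonneg _))
      _ = ‖ζ‖ * (|ν| * (4 * Real.pi ^ 2 * freqNormSq k) * ‖u‖) := by ring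
  -- the inertial term
  have h3 : |inertialPairing (u : Lp (EuclideanSpace ℝ (Fin 3)) 2 (volume : Measure (UnitAddTorus (Fin 3)))) w| ≤
      ‖ζ‖ * (2 * Real.pi * Real.sqrt (freqNormSq k) * ‖u‖ ^ 2) := by
    unfold inertialPairing
    rw [← Real.norm_eq_abs, ← hnorm, ← integral_norm_sq_coe_eq, ← mul_assoc, ← integral_const_mul]
    refine norm_integral_le_of_norm_le ((hu2.integrable_norm_pow two_ne_zero).const_mul _)
      (ae_of_all _ fun x => ?_)
    rw [Real.norm_eq_abs]
    refine (abs_real_inner_le_norm _ _).trans ?_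
    calc ‖Torus.fderiv w x (((u : Lp (EuclideanSpace ℝ (Fin 3)) 2 (volume : Measure (UnitAddTorus (Fin 3)))) :
            UnitAddTorus (Fin 3) → EuclideanSpace ℝ (Fin 3)) x)‖ *
          ‖((u : Lp (EuclideanSpace ℝ (Fin 3)) 2 (volume : Measure (UnitAddTorus (Fin 3)))) :
            UnitAddTorus (Fin 3) → EuclideanSpace ℝ (Fin 3)) x‖
        ≤ (2 * Real.pi * Real.sqrt (freqNormSq k) * ‖ζ‖ *
            ‖((u : Lp (EuclideanSpace ℝ (Fin 3)) 2 (volume : Measure (UnitAddTorus (Fin 3)))) :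
              UnitAddTorus (Fin 3) → EuclideanSpace ℝ (Fin 3)) x‖) *
            ‖((u : Lp (EuclideanSpace ℝ (Fin 3)) 2 (volume : Measure (UnitAddTorus (Fin 3)))) :
              UnitAddTorus (Fin 3) → EuclideanSpace ℝ (Fin 3)) x‖ :=
          mul_le_mul_of_nonneg_right (norm_fderiv_realTrigPoly_singleton_le k ζ x _) (norm_nonneg _)
      _ = ‖ζ‖ * (2 * Real.pi * Real.sqrt (freqNormSq k)) *
            ‖((u : Lp (EuclideanSpace ℝ (Fin 3)) 2 (volume : Measure (UnitAddTorus (Fin 3)))) :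
              UnitAddTorus (Fin 3) → EuclideanSpace ℝ (Fin 3)) x‖ ^ 2 := by ring
  unfold nsGeneratorPairing
  calc |(∫ x, ⟪f x, w x⟫_ℝ) + ν * (∫ x, ⟪((u : Lp (EuclideanSpace ℝ (Fin 3)) 2
            (volume : Measure (UnitAddTorus (Fin 3)))) : UnitAddTorus (Fin 3) → EuclideanSpace ℝ (Fin 3)) x,
            laplacian w x⟫_ℝ) +
          inertialPairing (u : Lp (EuclideanSpace ℝ (Fin 3)) 2 (volume : Measure (UnitAddTorus (Fin 3)))) w|
      ≤ |∫ x, ⟪f x, w x⟫_ℝ| + |ν * ∫ x, ⟪((u : Lp (EuclideanSpace ℝ (Fin 3)) 2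
            (volume : Measure (UnitAddTorus (Fin 3)))) : UnitAddTorus (Fin 3) → EuclideanSpace ℝ (Fin 3)) x,
            laplacian w x⟫_ℝ| +
          |inertialPairing (u : Lp (EuclideanSpace ℝ (Fin 3)) 2 (volume : Measure (UnitAddTorus (Fin 3)))) w| :=
        abs_add_three _ _ _
    _ ≤ ‖ζ‖ * (∫ x, ‖f x‖) + ‖ζ‖ * (|ν| * (4 * Real.pi ^ 2 * freqNormSq k) * ‖u‖) +
          ‖ζ‖ * (2 * Real.pi * Real.sqrt (freqNormSq k) * ‖u‖ ^ 2) := add_le_add_three h1 h2 h3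
    _ = _ := by ring

/-! ### (L1) `stub_augCurrentLevelBasisTools` -/

/-- **(L1) Basis tools (A1) + (A5).** For every `N` an `L²`-orthonormal basis of the real
solenoidal mean-zero trigonometric polynomials with spectrum in `freqBall N`, made of smooth
solenoidal mean-zero fields, complete (`Σⱼ (u, gⱼ) gⱼ = P_N u` on `H` and on smooth solenoidal
mean-zero test fields), Bessel, and the modewise rate bound of the Riesz representer
`Σⱼ ⟨F(u), gⱼ⟩ gⱼ` of the tested generator on the ball `‖u‖ ≤ R`:
`‖𝓕(Σⱼ ⟨F(u), gⱼ⟩ gⱼ)(k)‖ ≤ pathLip ν ‖f‖₁ R k − 1` (tested against the single real mode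
`Re (e_k r̂_u(k))`, see the module docstring). -/
theorem stub_augCurrentLevelBasisTools (ν : ℝ) {f : UnitAddTorus (Fin 3) → EuclideanSpace ℝ (Fin 3)}
    (hf : IsSmooth f) {R : ℝ} (hR : 0 ≤ R) (N : ℕ) :
    ∃ (D : ℕ) (g : Fin D → UnitAddTorus (Fin 3) → EuclideanSpace ℝ (Fin 3)),
      (∀ j, IsSmooth (g j)) ∧ (∀ j, IsDivFree (g j)) ∧ (∀ j, HasZeroMean (g j)) ∧
      (∀ i j, ∫ x, ⟪g i x, g j x⟫_ℝ = if i = j then 1 else 0) ∧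
      (∀ j k, k ∉ freqBall N → mFourierCoeff (EuclideanSpace.complexify ∘ g j) k = 0) ∧
      (∀ u : Torus.energySpace (Fin 3), ∀ x,
        ∑ j, pairing u.1 (g j) • g j x =
          fourierTruncate N (u.1 : UnitAddTorus (Fin 3) → EuclideanSpace ℝ (Fin 3)) x) ∧
      (∀ a : UnitAddTorus (Fin 3) → EuclideanSpace ℝ (Fin 3), IsSmooth a → IsDivFree a → HasZeroMean a →
        ∀ x, ∑ j, (∫ y, ⟪a y, g j y⟫_ℝ) • g j x = fourierTruncate N a x) ∧
      (∀ u : Torus.energySpace (Fin 3), ∑ j, (pairing u.1 (g j)) ^ 2 ≤ ‖u‖ ^ 2) ∧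
      (∀ u : Torus.energySpace (Fin 3), ‖u‖ ≤ R → ∀ k,
        ‖mFourierCoeff (EuclideanSpace.complexify ∘ fun x => ∑ j, nsGeneratorPairing ν f u (g j) • g j x) k‖ ≤
          pathLip ν (∫ x, ‖f x‖) R k - 1) := by
  classical
  obtain ⟨D, g, hband, horth, hcompl⟩ := MomentParityQuarticGate.exists_bandBasis N
  have hg : ∀ j, IsSmooth (g j) := fun j => (hband j).1
  have hgdiv : ∀ j, IsDivFree (g j) := fun j => (hband j).2.1
  have hg0 : ∀ j, HasZeroMean (g j) := fun j => (hband j).2.2.1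
  have hgN' : ∀ j, ∀ k ∉ (freqBall N).erase (0 : Fin 3 → ℤ),
      mFourierCoeff (EuclideanSpace.complexify ∘ g j) k = 0 := fun j => (hband j).2.2.2
  have hgN : ∀ j k, k ∉ freqBall N → mFourierCoeff (EuclideanSpace.complexify ∘ g j) k = 0 :=
    fun j k hk => hgN' j k fun h => hk (Finset.mem_of_mem_erase h)
  -- the `L²` classes of the basis fields
  have hgm : ∀ j, MemLp (g j) 2 volume := fun j => (hg j).memLp 2
  set G : Fin D → Lp (EuclideanSpace ℝ (Fin 3)) 2 (volume : Measure (UnitAddTorus (Fin 3))) :=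
    fun j => (hgm j).toLp (g j) with hG
  have hGae : ∀ j, (G j : UnitAddTorus (Fin 3) → EuclideanSpace ℝ (Fin 3)) =ᵐ[volume] g j :=
    fun j => (hgm j).coeFn_toLp
  have hGorth : Orthonormal ℝ G := by
    rw [orthonormal_iff_ite]
    intro i j
    rw [L2.inner_def, ← horth i j]
    refine integral_congr_ae ?_
    filter_upwards [hGae i, hGae j] with x hx hy
    rw [hx, hy]
  have hpair : ∀ (u : Torus.energySpace (Fin 3)) (j : Fin D), pairing u.1 (g j) = ⟪G j, u.1⟫_ℝ :=
    fun u j => by rw [pairing_eq_inner (hgm j), real_inner_comm]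
  -- completeness on `H`
  have hH : ∀ u : Torus.energySpace (Fin 3), ∀ x, ∑ j, pairing u.1 (g j) • g j x =
      fourierTruncate N (u.1 : UnitAddTorus (Fin 3) → EuclideanSpace ℝ (Fin 3)) x := by
    intro u x
    have hint : Integrable (u.1 : UnitAddTorus (Fin 3) → EuclideanSpace ℝ (Fin 3)) volume :=
      (Lp.memLp u.1).integrable one_le_two
    set Pu : UnitAddTorus (Fin 3) → EuclideanSpace ℝ (Fin 3) :=
      fourierTruncate N (u.1 : UnitAddTorus (Fin 3) → EuclideanSpace ℝ (Fin 3)) with hPu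
    have hPuc : Continuous Pu := continuous_fourierTruncate N _
    have hPuF : ∀ k, mFourierCoeff (EuclideanSpace.complexify ∘ Pu) k =
        if k ∈ freqBall N then mFourierCoeff (EuclideanSpace.complexify ∘
          (u.1 : UnitAddTorus (Fin 3) → EuclideanSpace ℝ (Fin 3))) k else 0 :=
      fun k => mFourierCoeff_fourierTruncate hint N k
    -- `P_N u ∈ H`
    set v : Lp (EuclideanSpace ℝ (Fin 3)) 2 (volume : Measure (UnitAddTorus (Fin 3))) :=
      ContinuousMap.toLp (E := EuclideanSpace ℝ (Fin 3)) 2 volume ℝ ⟨Pu, hPuc⟩ with hv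
    have hvH : v ∈ Torus.energySpace (Fin 3) :=
      galerkinSpace_le_energySpace_holds N (toLp_fourierTruncate_mem_galerkinSpace u.2 N)
    have hvae : (v : UnitAddTorus (Fin 3) → EuclideanSpace ℝ (Fin 3)) =ᵐ[volume] Pu :=
      ContinuousMap.coeFn_toLp (E := EuclideanSpace ℝ (Fin 3)) volume _
    have hvF : ∀ k, mFourierCoeff (EuclideanSpace.complexify ∘
        (v : UnitAddTorus (Fin 3) → EuclideanSpace ℝ (Fin 3))) k =
        mFourierCoeff (EuclideanSpace.complexify ∘ Pu) k :=
      fun k => mFourierCoeff_congr_ae (hvae.fun_comp EuclideanSpace.complexify) k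
    have hvband : ∀ k ∉ (freqBall N).erase (0 : Fin 3 → ℤ), mFourierCoeff (EuclideanSpace.complexify ∘
        (v : UnitAddTorus (Fin 3) → EuclideanSpace ℝ (Fin 3))) k = 0 := by
      intro k hk
      rw [hvF, hPuF]
      by_cases hk0 : k = 0
      · subst hk0
        rw [if_pos (zero_mem_freqBall N)]
        exact mFourierCoeff_complexify_coe_zero_of_mem u.2
      · rw [if_neg fun h => hk (Finset.mem_erase.2 ⟨hk0, h⟩)]
    have key := hcompl ⟨v, hvH⟩ hvband x
    -- the truncation of `P_N u` is `P_N u`, its pairings are those of `u`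
    have hL : fourierTruncate N (v : UnitAddTorus (Fin 3) → EuclideanSpace ℝ (Fin 3)) = Pu := by
      rw [fourierTruncate_eq, realTrigPoly_congr fun k _ => hvF k, ← fourierTruncate_eq]
      refine fourierTruncate_eq_self hPuc fun k hk => ?_
      rw [hPuF, if_neg (not_mem_freqBall.2 hk)]
    have hRj : ∀ j, pairing v (g j) = pairing u.1 (g j) := fun j => by
      rw [pairing, pairing, integral_congr_ae (hvae.mono fun y hy => by
        show ⟪(v : UnitAddTorus (Fin 3) → EuclideanSpace ℝ (Fin 3)) y, g j y⟫_ℝ = ⟪Pu y, g j y⟫_ℝ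
        rw [hy])]
      exact integral_inner_fourierTruncate_eq (Lp.memLp u.1) (hgm j) (hgN j)
    have key' : fourierTruncate N (v : UnitAddTorus (Fin 3) → EuclideanSpace ℝ (Fin 3)) x =
        ∑ j, pairing v (g j) • g j x := key
    rw [hL] at key'
    simp_rw [hRj] at key'
    exact key'.symm
  -- completeness on smooth solenoidal mean-zero test fields
  have hA : ∀ a : UnitAddTorus (Fin 3) → EuclideanSpace ℝ (Fin 3), IsSmooth a → IsDivFree a →
      HasZeroMean a → ∀ x, ∑ j, (∫ y, ⟪a y, g j y⟫_ℝ) • g j x = fourierTruncate N a x := by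
    intro a ha hdiv h0 x
    have ham : MemLp a 2 volume := ha.memLp 2
    have hmem : ham.toLp a ∈ Torus.energySpace (Fin 3) :=
      smoothSolenoidal_subset_energySpace ⟨a, ha, hdiv, h0, ham.coeFn_toLp⟩
    have key := hH ⟨ham.toLp a, hmem⟩ x
    have h1 : ∀ j, pairing (ham.toLp a) (g j) = ∫ y, ⟪a y, g j y⟫_ℝ := fun j =>
      integral_congr_ae (ham.coeFn_toLp.mono fun y hy => by
        show ⟪(ham.toLp a : UnitAddTorus (Fin 3) → EuclideanSpace ℝ (Fin 3)) y, g j y⟫_ℝ = ⟪a y, g j y⟫_ℝ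
        rw [hy])
    have h2 : fourierTruncate N (ham.toLp a : UnitAddTorus (Fin 3) → EuclideanSpace ℝ (Fin 3)) =
        fourierTruncate N a := by
      rw [fourierTruncate_eq, fourierTruncate_eq]
      exact realTrigPoly_congr fun k _ => mFourierCoeff_congr_ae (ham.coeFn_toLp.fun_comp _) k
    have key' : ∑ j, pairing (ham.toLp a) (g j) • g j x =
        fourierTruncate N (ham.toLp a : UnitAddTorus (Fin 3) → EuclideanSpace ℝ (Fin 3)) x := key
    simp_rw [h1, h2] at key'
    exact key'
  refine ⟨D, g, hg, hgdiv, hg0, horth, hgN, hH, hA, fun u => ?_, fun u huR k => ?_⟩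
  · -- Bessel
    have h := hGorth.sum_inner_products_le u.1 (s := Finset.univ)
    simp_rw [hpair]
    simpa only [Real.norm_eq_abs, sq_abs, Submodule.coe_norm] using h
  · -- the rate bound
    have hA0 : 0 ≤ ∫ x, ‖f x‖ := integral_nonneg fun _ => norm_nonneg _
    have hL0 : 0 ≤ pathLip ν (∫ x, ‖f x‖) R k - 1 := by
      have h1 : 0 ≤ |ν| * (4 * Real.pi ^ 2 * freqNormSq k) * |R| := by
        have := freqNormSq_nonneg k; positivity
      have h2 : 0 ≤ 2 * Real.pi * Real.sqrt (freqNormSq k) * R ^ 2 := by positivity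
      rw [pathLip]; linarith
    set F : Fin D → ℝ := fun j => nsGeneratorPairing ν f u (g j) with hF
    set r : UnitAddTorus (Fin 3) → EuclideanSpace ℝ (Fin 3) := fun x => ∑ j, F j • g j x with hr
    set α : EuclideanSpace ℂ (Fin 3) := mFourierCoeff (EuclideanSpace.complexify ∘ r) k with hα
    have hrs : IsSmooth r := IsSmooth.sum_smul Finset.univ F hg
    have hrdiv : IsDivFree r := IsDivFree.sum_smul Finset.univ F hg hgdiv
    have hrF : ∀ k', mFourierCoeff (EuclideanSpace.complexify ∘ r) k' =
        ∑ j, (F j : ℂ) • mFourierCoeff (EuclideanSpace.complexify ∘ g j) k' := fun k' =>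
      MomentParityQuarticGate.mFourierCoeff_complexify_sum_smul Finset.univ F (fun j => (hg j).continuous) k'
    by_cases hk : k ∈ (freqBall N).erase (0 : Fin 3 → ℤ)
    swap
    · -- off the band the representer has no mode
      have h0 : α = 0 := by
        rw [hα, hrF]
        exact Finset.sum_eq_zero fun j _ => by rw [hgN' j k hk, smul_zero]
      rw [h0, norm_zero]
      exact hL0
    obtain ⟨hk0, hkN⟩ := Finset.mem_erase.1 hk
    -- the test mode `w = Re (e_k α)`
    set w : UnitAddTorus (Fin 3) → EuclideanSpace ℝ (Fin 3) := realTrigPoly {k} fun _ => α with hw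
    have hws : IsSmooth w := isSmooth_realTrigPoly _ _
    have hwdiv : IsDivFree w :=
      isDivFree_realTrigPoly_singleton (hrdiv.sum_mul_mFourierCoeff_eq_zero hrs k)
    have hw0 : HasZeroMean w := by
      unfold HasZeroMean
      simp_rw [hw, realTrigPoly_singleton_apply]
      have hint : Integrable (fun x : UnitAddTorus (Fin 3) => mFourier k x • α) volume :=
        ((mFourier k).continuous.smul continuous_const).integrable_unitAddTorus
      rw [ContinuousLinearMap.integral_comp_comm _ hint, integral_smul_const, integral_mFourier,
        if_neg hk0, zero_smul, map_zero]
    have hwband : ∀ k', (N : ℝ) ^ 2 < freqNormSq k' →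
        mFourierCoeff (EuclideanSpace.complexify ∘ w) k' = 0 := fun k' hk' =>
      mFourierCoeff_realTrigPoly_singleton_eq_zero k _ ((mem_freqBall.1 hkN).trans_lt hk')
    -- `w` is synthesized by the basis
    have hwsum : w = fun x => ∑ j, (∫ y, ⟪w y, g j y⟫_ℝ) • g j x := by
      funext x
      rw [hA w hws hwdiv hw0 x, fourierTruncate_eq_self hws.continuous hwband]
    -- `⟨F(u), w⟩ = Σⱼ (w, gⱼ) Fⱼ`
    have hFw : nsGeneratorPairing ν f u w = ∑ j, (∫ y, ⟪w y, g j y⟫_ℝ) * F j := by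
      conv_lhs => rw [hwsum]
      exact nsGeneratorPairing_sum_smul ν hf.integrable u Finset.univ _ fun j _ => hg j
    -- `(r, w) = ‖α‖²` and `(r, w) = Σⱼ Fⱼ (w, gⱼ)`
    have hrw1 : ∫ x, ⟪r x, w x⟫_ℝ = ‖α‖ ^ 2 := by
      rw [hw, integral_inner_realTrigPoly_singleton hrs.integrable k]
      exact inner_self_eq_norm_sq (𝕜 := ℂ) α
    have hrw2 : ∫ x, ⟪r x, w x⟫_ℝ = ∑ j, F j * ∫ y, ⟪w y, g j y⟫_ℝ := by
      have hij : ∀ j, Integrable (fun y => ⟪g j y, w y⟫_ℝ) volume := fun j =>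
        integrable_inner_of_continuous (hg j).integrable hws.continuous
      simp_rw [hr, sum_inner, real_inner_smul_left]
      rw [integral_finsetSum _ fun j _ => (hij j).const_mul (F j)]
      refine Finset.sum_congr rfl fun j _ => ?_
      rw [integral_const_mul]
      congr 1
      exact integral_congr_ae (ae_of_all _ fun y => real_inner_comm _ _)
    -- the bound
    have hbound := abs_nsGeneratorPairing_singleton_le ν hf.integrable u k α
    have hmono : (∫ x, ‖f x‖) + |ν| * (4 * Real.pi ^ 2 * freqNormSq k) * ‖u‖ +
        2 * Real.pi * Real.sqrt (freqNormSq k) * ‖u‖ ^ 2 ≤ pathLip ν (∫ x, ‖f x‖) R k - 1 := by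
      rw [pathLip, abs_of_nonneg hR]
      have hu0 : 0 ≤ ‖u‖ := norm_nonneg _
      have h1 : |ν| * (4 * Real.pi ^ 2 * freqNormSq k) * ‖u‖ ≤ |ν| * (4 * Real.pi ^ 2 * freqNormSq k) * R :=
        mul_le_mul_of_nonneg_left huR (by have := freqNormSq_nonneg k; positivity)
      have h2 : 2 * Real.pi * Real.sqrt (freqNormSq k) * ‖u‖ ^ 2 ≤
          2 * Real.pi * Real.sqrt (freqNormSq k) * R ^ 2 :=
        mul_le_mul_of_nonneg_left (pow_le_pow_left₀ hu0 huR 2) (by positivity)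
      linarith
    have hsq : ‖α‖ * ‖α‖ ≤ ‖α‖ * (pathLip ν (∫ x, ‖f x‖) R k - 1) :=
      calc ‖α‖ * ‖α‖ = nsGeneratorPairing ν f u w := by
            rw [← sq, ← hrw1, hrw2, hFw]
            exact Finset.sum_congr rfl fun j _ => mul_comm _ _
        _ ≤ |nsGeneratorPairing ν f u w| := le_abs_self _
        _ ≤ ‖α‖ * ((∫ x, ‖f x‖) + |ν| * (4 * Real.pi ^ 2 * freqNormSq k) * ‖u‖ +
              2 * Real.pi * Real.sqrt (freqNormSq k) * ‖u‖ ^ 2) := hbound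
        _ ≤ ‖α‖ * (pathLip ν (∫ x, ‖f x‖) R k - 1) := mul_le_mul_of_nonneg_left hmono (norm_nonneg _)
    by_cases hα0 : ‖α‖ = 0
    · rw [hα0]
      exact hL0
    · exact le_of_mul_le_mul_left hsq ((norm_nonneg _).lt_of_ne (Ne.symm hα0))

end Summit.AnomalousDissipation.AnomalousDissipation.Theorems.EnsembleRealization
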